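import Literature.AnabelianGeometry.EtaleTheta.TemperedFrobenioidOfGaloisCoveringRankOnePoint
import Literature.AnabelianGeometry.EtaleTheta.TemperedFrobenioidOfGaloisCoveringOneComponent
import Literature.AnabelianGeometry.EtaleTheta.DivisorMonoidsOfGaloisCoveringCoset

/-!
# [EtTh] Def 3.6 (ii): a tempered Frobenioid over ANY Def 3.3 (iii) datum at a RANK-ONE OBJECT (weak vocabulary of
# record) — the `dm`-generic form of abc-iut-w6-d048's rank-one-point engine, and the FIRST tempered Frobenioids over
# the COSET-model constructed data (non-vacuity of the coset-model theorem families)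

S. Mochizuki, *The étale theta function …*, Publ. RIMS **45** (2009) [MochizukiEtTh2009], Def. 3.3 (iii) PDF p.73, Rmk.
3.3.1 p.73, Def. 3.6 (i)(ii) pp.76–77 [cite: MochizukiEtTh2009, Def 3.6 p.77]; S. Mochizuki, *The geometry of Frobenioids
II* (2008), Ex. 1.1 (the `p`-adic Frobenioid) [cite: MochizukiFrdII2008, Ex. 1.1 p.408].

abc-iut cell, layer L2; seat abc-iut-w5-d179 (gen 5), SUBDAG-EtTh-Thm44 custodian lineage.  CLASS (b) MODEL / NON-VACUITY
construction (one structure + defs; 0 instances / notation / `Prop` facts; flagged to ref-d).  CREDIT: the construction is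
VERBATIM abc-iut-w6-d048's `TemperedFrobenioid.ofRankOnePoint` (`TemperedFrobenioidOfGaloisCoveringRankOnePoint.lean`,
p444230) with the particular datum `DivisorMonoids.ofGaloisActionConnected A hZ` and its point `S₀` replaced by an ARBITRARY
Def. 3.3 (iii) datum `dm : DivisorMonoids D₀` and object `Y₀ : D₀`; abc-iut-w6-d048's one-component model
(`LogDivisorModel.oneComp`, `OneCompFrd.phiZeroEquivNat`, p443841 / p444302), abc-iut-w6-d058's `GaloisAction.trivial` and this
lineage's coset model `DivisorMonoids.ofGaloisActionCoset` (p442175) are consumed BY NAME; nothing landed is edited.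

WHY.  abc-iut-w6-d048's engine lifts the vacuity finding F-w6d048g3-1 for the theorem families over the CONNECTED model
`ofGaloisActionConnected`; this lineage's Thm 4.4 files over the COSET model (p443031, p443606 — incl. [EtTh] Thm 4.4 IN
FULL ⇐ {T44-L15b} —, p444666) quantify over `TemperedFrobenioid (ofRlfZWeak (DivisorMonoids.ofGaloisActionCoset A hZ) hpf) …`,
a class with no inhabitant so far.  A `dm`-generic engine serves both models (and any base change `DivisorMonoids.precomp`):

* `DivisorMonoids.RankOneObject dm` — an object `Y₀` with `e : Φ₀(Y₀) ≃* ℕ` over which every log-divisor is `div₀` of a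
  constant (`hcnst`); `TemperedFrobenioid.ofRankOneObject P hpf R S : TemperedFrobenioid (ofRlfZWeak dm hpf) (Discrete PUnit)
  (treeCatVocab …)` — `D = {pt} ↦ Y₀`, `Φ := im(Φ₀(Y₀)^pf → Φ₀(Y₀)^rlf) ≅ ℚ_{≥0}`, (a) `Φ^{bs-fld} = Φ` monoprime via `hcnst` +
  root-closure, (b) the generator `ι(e⁻¹ 1) ≠ 1` is the divisor of a constant; `isFrobenioid_ofRankOneObject` ([FrdI] Thm.
  5.2 (ii)); `ofRankOneObjectConnectedPart` — re-based to print's genuine base `B^temp(Π)⁰` for every topological group `Π`;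
* COSET INSTANCES: `OneCompCoset.rankOneObject U hU H` — at the one-component model with `G = 1`, every object `H` of the coset
  model is rank-one (`Φ₀(G/H) ≅ ℕ` by `OneCompFrd.phiZeroEquivNat`; constants `u·ϖⁿ` have divisor `n·[F]`); hence
  **`OneCompCoset.temperedFrobenioid`** — the first tempered Frobenioid over
  `ofRlfZWeak (DivisorMonoids.ofGaloisActionCoset (GaloisAction.trivial (oneComp U hU) 1) _) _` — and
  `nonempty_temperedFrobenioid_ofGaloisActionCoset[_connectedPart]`: **the coset-model theorem families are NON-VACUOUS**
  (over `Discrete PUnit` and over `B^temp(Π)⁰` for every `Π`).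
HONEST LABEL: genuine vocabularies and the constructed data, but DEGENERATE GEOMETRY at the instance (one component, no cusps,
all log-meromorphic functions constant; `D` one object) — a consistency / instantiation witness, not the tempered Frobenioid
of a Tate curve; `BiKummerSetting` / `Thm44Hyp` data are NOT claimed inhabited here.  Nothing here bears on [IUTchIII]
Cor. 3.12; no side taken; typed ≠ proved for anything else.
-/

noncomputable section

namespace Literature.AnabelianGeometry.EtaleTheta

open CategoryTheory Opposite Function Literature.AlgebraicGeometry.Frobenioids
  Literature.AnabelianGeometry.SemiGraphs LogDivisorModel LogDivisorModel.GaloisAction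

universe u₀ v₀

/-! ### Rank-one objects of an arbitrary Def 3.3 (iii) datum -/

namespace DivisorMonoids

variable {D₀ : Type u₀} [Category.{v₀} D₀] (dm : DivisorMonoids.{u₀, v₀, 0} D₀)

/-- **A rank-one object of Def. 3.3 (iii) data `dm`**: an object `Y₀` of `D₀` with `Φ₀(Y₀) ≅ ℕ` (one Galois orbit of prime
log-divisors, Rmk. 3.3.1) over which every log-divisor is the divisor of a constant log-meromorphic function
(`Φ₀^birat = Φ₀^cnst = Φ₀^gp`) — the `dm`-generic form of abc-iut-w6-d048's `RankOnePoint`.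
[cite: MochizukiEtTh2009, Def 3.3 p.73] -/
structure RankOneObject : Type (max u₀ 1) where
  /-- the rank-one object `Y₀` -/
  Y₀ : D₀
  /-- `Φ₀(Y₀) ≅ ℕ` -/
  e : dm.Φ₀.obj (op Y₀) ≃* Multiplicative ℕ
  /-- every log-divisor over `Y₀` is the divisor of a constant log-meromorphic function -/
  hcnst : ∀ m : dm.Φ₀.obj (op Y₀), ∃ b ∈ dm.F₀ (op Y₀), dm.div₀ (op Y₀) b = Algebra.GrothendieckGroup.of m

variable {dm} (P : dm.RankOneObject) (hpf : ∀ Y : D₀ᵒᵖ, IsPerfFactorialCof (dm.Φ₀.obj Y))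

namespace RankOneObject

/-- `Φ₀(Y₀)` is monoprime. [cite: MochizukiEtTh2009, Rmk 3.3.1 p.73] -/
theorem isMonoprime_Φ₀ : IsMonoprime (dm.Φ₀.obj (op P.Y₀)) :=
  IsMonoprime.of_mulEquiv P.e.symm isMonoprime_multiplicative_nat

/-- `Φ₀(Y₀)` is perf-factorial in the PRINTED sense. [cite: MochizukiEtTh2009, Prop 3.4 p.74] -/
theorem isPerfFactorial_Φ₀ : IsPerfFactorial (dm.Φ₀.obj (op P.Y₀)) :=
  MonoprimeStructure.isPerfFactorial P.isMonoprime_Φ₀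

/-- The base functor `{pt} → D₀`, `pt ↦ Y₀`. [cite: MochizukiEtTh2009, Def 3.6 p.76] -/
abbrev base : Discrete PUnit.{1} ⥤ D₀ := (Functor.const (Discrete PUnit.{1})).obj P.Y₀

/-- `Φ := im(Φ₀(Y₀)^pf → Φ₀(Y₀)^rlf)` (weak realification map). [cite: MochizukiEtTh2009, Def 3.6 p.76] -/
def pfImage : Submonoid ((RealifiedDivisorMonoids.ofRlfZWeak dm hpf).ΦR.obj (op P.Y₀)) :=
  MonoidHom.mrange (hpf (op P.Y₀)).weak.toRealification

/-- Every element of `Φ` is base-field-theoretic: its class lies in `ℝ·Φ₀^cnst(Y₀)` (by `hcnst` and root-closure).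
[cite: MochizukiEtTh2009, Def 3.6 p.77] -/
theorem of_mem_cnstR_of_mem_pfImage {x : (RealifiedDivisorMonoids.ofRlfZWeak dm hpf).ΦR.obj (op P.Y₀)} (hx : x ∈ P.pfImage hpf) :
    Algebra.GrothendieckGroup.of x ∈ (RealifiedDivisorMonoids.ofRlfZWeak dm hpf).cnstR (op P.Y₀) := by
  obtain ⟨a, rfl⟩ := hx
  obtain ⟨⟨m, n⟩, rfl⟩ := Perfection.mk_surjective a
  apply (RealifiedDivisorMonoids.ofRlfZWeak dm hpf).mem_cnstR_of_pow_mem _ n.ne_zero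
  rw [← map_pow, ← map_pow, Perfection.mk_pow_self]
  obtain ⟨b, hb, hbm⟩ := P.hcnst m
  have key : EtaleTheta.gpMap ((RealifiedDivisorMonoids.ofRlfZWeak dm hpf).toR (op P.Y₀)) (dm.div₀ (op P.Y₀) b) ∈
      (RealifiedDivisorMonoids.ofRlfZWeak dm hpf).cnstR (op P.Y₀) :=
    (RealifiedDivisorMonoids.ofRlfZWeak dm hpf).cnst_le_cnstR (op P.Y₀) b hb
  have h : EtaleTheta.gpMap ((RealifiedDivisorMonoids.ofRlfZWeak dm hpf).toR (op P.Y₀)) (dm.div₀ (op P.Y₀) b) =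
      Algebra.GrothendieckGroup.of ((hpf (op P.Y₀)).weak.toRealification (Perfection.of _ m)) := by
    rw [hbm]
    exact EtaleTheta.gpMap_of _ _
  exact (congrArg (· ∈ (RealifiedDivisorMonoids.ofRlfZWeak dm hpf).cnstR (op P.Y₀)) h).mp key

/-- `Φ ∩ ℝ·Φ₀^cnst = Φ` ("`Φ^{bs-fld} = Φ`"). [cite: MochizukiEtTh2009, Def 3.6 p.77] -/
theorem pfImage_inf_cnstR_eq :
    P.pfImage hpf ⊓ ((RealifiedDivisorMonoids.ofRlfZWeak dm hpf).cnstR (op P.Y₀)).toSubmonoid.comap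
      Algebra.GrothendieckGroup.of = P.pfImage hpf :=
  inf_eq_left.mpr fun _ hx => P.of_mem_cnstR_of_mem_pfImage hpf hx

/-- `Φ` is monoprime. [cite: MochizukiEtTh2009, Def 3.6 p.77] -/
theorem isMonoprime_pfImage : IsMonoprime ↥(P.pfImage hpf) :=
  Example39NV.isMonoprime_mrange_toRealification P.isMonoprime_Φ₀

/-- The generator `ι(e⁻¹ 1) ∈ Φ` is not `1`. [cite: MochizukiEtTh2009, Def 3.6 p.77] -/
theorem toRealification_gen_ne_one :
    (hpf (op P.Y₀)).weak.toRealification (Perfection.of _ (P.e.symm (Multiplicative.ofAdd 1))) ≠ 1 := by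
  intro h
  have h1 := PfImageWeak.toRealification_injective (hpf (op P.Y₀)).weak (h.trans (map_one _).symm)
  have h2 : P.e.symm (Multiplicative.ofAdd 1) = 1 :=
    (Perfection.mk_eq_one_iff_of_isSharp (MonoprimeStructure.isSharp P.isMonoprime_Φ₀)).mp h1
  have h3 : (Multiplicative.ofAdd (1 : ℕ) : Multiplicative ℕ) = 1 := by
    rw [← P.e.apply_symm_apply (Multiplicative.ofAdd 1), h2, map_one]
  exact one_ne_zero (ofAdd_eq_one.mp h3)

/-- `Φ ⊆ Φ^{ℝ-log}|_D` as a subfunctor in monoids over the constant base functor. [cite: MochizukiEtTh2009, Def 3.6 p.76] -/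
def Φsub : SubMonoidOn ((P.base).op ⋙ (RealifiedDivisorMonoids.ofRlfZWeak dm hpf).ΦR) where
  carrier _ := P.pfImage hpf
  map_mem := by
    rintro X Y f _ ⟨a, rfl⟩
    exact ⟨Perfection.map (dm.Φ₀.map (P.base.map f.unop).op).hom a,
      (DFunLike.congr_fun (rlfMapWeak_comp_toRealification dm.Φ₀ hpf (P.base.map f.unop).op) a).symm⟩

end RankOneObject

end DivisorMonoids

/-! ### The tempered Frobenioid at a rank-one object -/

namespace TemperedFrobenioid

variable {D₀ : Type u₀} [Category.{v₀} D₀] {dm : DivisorMonoids.{u₀, v₀, 0} D₀} (P : dm.RankOneObject)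
  (hpf : ∀ Y : D₀ᵒᵖ, IsPerfFactorialCof (dm.Φ₀.obj Y)) (R S : ((Discrete PUnit.{1})ᵒᵖ ⥤ CommMonCat.{0}) → Prop)

/-- **Def. 3.6 (ii) data over ANY Def. 3.3 (iii) datum at a rank-one object** (monoid type `ℤ`, weak vocabulary of record):
`D = {pt} ↦ Y₀`, `Φ := im(Φ₀(Y₀)^pf → Φ₀(Y₀)^rlf)`; every condition PROVED — the `p`-adic Frobenioid of the constant field of
`Y₀` ([FrdII] Ex. 1.1); abc-iut-w6-d048's `ofRankOnePoint`, `dm`-generic. [cite: MochizukiEtTh2009, Def 3.6 p.77] -/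
def ofRankOneObject : TemperedFrobenioid (RealifiedDivisorMonoids.ofRlfZWeak dm hpf) (Discrete PUnit.{1})
    (treeCatVocab (Discrete PUnit.{1}) R S) where
  isConnected := Toy.temperedFrobenioid.isConnected
  isTotallyEpimorphic := Toy.temperedFrobenioid.isTotallyEpimorphic
  base := P.base
  Φ := P.Φsub hpf
  isGroupSaturated _ := PfImageWeak.isGroupSaturated_mrange_toRealification (hpf (op P.Y₀)).weak
  isPerfFactorial _ := PfImageWeak.isPerfFactorialCof_mrange_toRealification (hpf (op P.Y₀))
  isDivisorialOn := by
    rw [treeCatVocab_isDivisorialOn]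
    exact ⟨Cor38Toy.isMonoidOn_of_punit _, fun _ => PfImageWeak.isDivisorial_mrange_toRealification (hpf (op P.Y₀))⟩
  isMonoprime_bsFld _ :=
    IsMonoprime.of_mulEquiv (MulEquiv.submonoidCongr (P.pfImage_inf_cnstR_eq hpf).symm) (P.isMonoprime_pfImage hpf)
  exists_FΛ_div_ne _ := by
    obtain ⟨b, hb, hbm⟩ := P.hcnst (P.e.symm (Multiplicative.ofAdd 1))
    refine ⟨b, hb, (hpf (op P.Y₀)).weak.toRealification (Perfection.of _ (P.e.symm (Multiplicative.ofAdd 1))), ⟨_, rfl⟩,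
      1, one_mem _, P.toRealification_gen_ne_one hpf, ?_⟩
    simp only [map_one, div_one]
    rw [RealifiedDivisorMonoids.ofRlfZWeak_divΛ_apply]
    change EtaleTheta.gpMap _ (dm.div₀ (op P.Y₀) b) = _
    rw [hbm]
    exact EtaleTheta.gpMap_of _ _

/-- `Φ` of the witness is `im(Φ₀^pf → Φ₀^rlf)`. [cite: MochizukiEtTh2009, Def 3.6 p.77] -/
@[simp] theorem ofRankOneObject_Φ_carrier (X : (Discrete PUnit.{1})ᵒᵖ) :
    (ofRankOneObject P hpf R S).Φ.carrier X = P.pfImage hpf := rfl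

/-- The base functor of the witness is constant at `Y₀`. [cite: MochizukiEtTh2009, Def 3.6 p.77] -/
@[simp] theorem ofRankOneObject_base : (ofRankOneObject P hpf R S).base = P.base := rfl

/-- **Non-vacuity** of «for every tempered Frobenioid over `ofRlfZWeak dm hpf`» at every datum with a rank-one object.
[cite: MochizukiEtTh2009, Def 3.6 p.77] -/
theorem nonempty_of_rankOneObject (P₀ : dm.RankOneObject) (R₀ S₀ : ((Discrete PUnit.{1})ᵒᵖ ⥤ CommMonCat.{0}) → Prop) :
    Nonempty (TemperedFrobenioid (RealifiedDivisorMonoids.ofRlfZWeak dm hpf) (Discrete PUnit.{1})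
      (treeCatVocab (Discrete PUnit.{1}) R₀ S₀)) :=
  ⟨ofRankOneObject P₀ hpf R₀ S₀⟩

/-- **The witness IS a Frobenioid** ([FrdI] Thm. 5.2 (ii)). [cite: MochizukiFrdI2008, Thm. 5.2 (ii) p.100] -/
theorem isFrobenioid_ofRankOneObject : PreFrobenioid.IsFrobenioid (ofRankOneObject P hpf R S).toElem :=
  ModelFrobenioid.isFrobenioid (Cor38Toy.isMonoidOn_of_punit _)
    (fun _ => PfImageWeak.isDivisorial_mrange_toRealification (hpf (op P.Y₀))) (Cor38Toy.isMonoidOn_of_punit _)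
    ((ofRankOneObject P hpf R S).isGroupLike_ratFnFunctor (RealifiedDivisorMonoids.ofRlfZWeak dm hpf).isUnit_BΛ)
    (isGraphConnected_iff_isConnected.mpr (ofRankOneObject P hpf R S).isConnected)
    (ofRankOneObject P hpf R S).isTotallyEpimorphic

section ConnectedPart

variable (Γ : Type) [Group Γ] [TopologicalSpace Γ] (R' S' : ((ConnectedPart (BTemp Γ))ᵒᵖ ⥤ CommMonCat.{0}) → Prop)

/-- **The same witness re-based to print's GENUINE base `B^temp(Π)⁰`** (abc-iut-w6-d048's `restrictConnectedPart` along the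
constant functor to the point), for EVERY topological group `Π`. [cite: MochizukiEtTh2009, Def 3.6 p.77] -/
def ofRankOneObjectConnectedPart :
    TemperedFrobenioid (RealifiedDivisorMonoids.ofRlfZWeak dm hpf) (ConnectedPart (BTemp Γ))
      (treeCatVocab (ConnectedPart (BTemp Γ)) R' S') :=
  (ofRankOneObject P hpf R S).restrictConnectedPart Γ ((Functor.const _).obj ⟨PUnit.unit⟩) R' S'

/-- Non-vacuity over the genuine base. [cite: MochizukiEtTh2009, Def 3.6 p.77] -/
theorem nonempty_of_rankOneObject_connectedPart (P₀ : dm.RankOneObject)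
    (R₁ S₁ : ((ConnectedPart (BTemp Γ))ᵒᵖ ⥤ CommMonCat.{0}) → Prop) :
    Nonempty (TemperedFrobenioid (RealifiedDivisorMonoids.ofRlfZWeak dm hpf) (ConnectedPart (BTemp Γ))
      (treeCatVocab (ConnectedPart (BTemp Γ)) R₁ S₁)) :=
  ⟨ofRankOneObjectConnectedPart P₀ hpf (fun _ => True) (fun _ => True) Γ R₁ S₁⟩

end ConnectedPart

end TemperedFrobenioid

/-! ### The coset-model data at the one-component model with `G = 1`: every object is rank-one -/

namespace OneCompCoset

variable (U : Type) [CommGroup U] (hU : ∀ u : U, (∀ N : ℕ+, ∃ g : U, g ^ (N : ℕ) = u) → u = 1)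

/-- The coset-model Def. 3.3 (iii) data at the one-component model, `G = 1` (objects `Subgroup PUnit`, `D₀ : Type 0`).
[cite: MochizukiEtTh2009, Def 3.3 p.73] -/
abbrev dm : DivisorMonoids.{0, 0, 0} (InducedCategory (Action (Type 0) PUnit.{1}) (cosetGSet PUnit.{1})) :=
  DivisorMonoids.ofGaloisActionCoset (OneCompFrd.act U hU) (cuspLaws_oneComp U hU)

/-- The coset object `G/H` seen in abc-iut-w6-d048's connected `D₀` (to reuse `OneCompFrd.phiZeroEquivNat`).
[cite: MochizukiEtTh2009, Def 3.3 p.73] -/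
abbrev asConnected (H : Subgroup PUnit.{1}) : OneCompFrd.D₀ := ⟨cosetGSet PUnit.{1} H, isConnectedGSet_cosetGSet _ H⟩

/-- The constant function `u·ϖⁿ` on `G/H`, an element of `B₀(G/H)`. [cite: MochizukiEtTh2009, Def 3.3 p.73] -/
def cnstFn (H : Subgroup PUnit.{1}) (u : U) (n : ℤ) : (OneCompFrd.act U hU).bZero (cosetGSet PUnit.{1} H) :=
  ⟨fun _ => ((u, Multiplicative.ofAdd n) : U × Multiplicative ℤ), fun _ => trivial, fun _ _ => rfl⟩

/-- `div₀(u·ϖⁿ) = n·[F]` over `G/H`. [cite: MochizukiEtTh2009, Def 3.3 p.73] -/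
theorem div₀_cnstFn (H : Subgroup PUnit.{1}) (u : U) (n : ℕ) :
    (dm U hU).div₀ (op H) (cnstFn U hU H u n) =
      Algebra.GrothendieckGroup.of (OneCompFrd.constPhi U hU (asConnected H) n : (dm U hU).Φ₀.obj (op H)) :=
  (((OneCompFrd.act U hU).divZeroHom_eq_div_iff _ _ (OneCompFrd.constPhi U hU (asConnected H) n) 1).2
    fun _ => mul_one _).trans (by rw [map_one, div_one])

/-- **Every object of the coset model at the one-component model is rank-one** (`Φ₀(G/H) ≅ ℕ`; every log-divisor `n·[F]`
is the divisor of the constant `ϖⁿ`). [cite: MochizukiEtTh2009, Def 3.3 p.73] -/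
def rankOneObject (H : Subgroup PUnit.{1}) : (dm U hU).RankOneObject where
  Y₀ := H
  e := OneCompFrd.phiZeroEquivNat U hU (asConnected H)
  hcnst m := by
    refine ⟨cnstFn U hU H 1 ((Multiplicative.toAdd (OneCompFrd.phiZeroEquivNat U hU (asConnected H) m) : ℕ) : ℤ),
      fun _ => trivial, ?_⟩
    rw [div₀_cnstFn]
    congr 1
    exact (OneCompFrd.phiZeroEquivNat U hU (asConnected H)).symm_apply_apply m

/-- Prop. 3.4 (i) (weak, cofinal perfection) for every `Φ₀` of the coset data (the `hpf` slot, proved).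
[cite: MochizukiEtTh2009, Prop 3.4 p.74] -/
abbrev hpf : ∀ Y : (InducedCategory (Action (Type 0) PUnit.{1}) (cosetGSet PUnit.{1}))ᵒᵖ,
    IsPerfFactorialCof ((dm U hU).Φ₀.obj Y) :=
  DivisorMonoids.ofGaloisActionCoset_isPerfFactorialCof (OneCompFrd.act U hU) (cuspLaws_oneComp U hU)

variable (R S : ((Discrete PUnit.{1})ᵒᵖ ⥤ CommMonCat.{0}) → Prop)

/-- **The first tempered Frobenioid over the COSET-model constructed data** (one-component model, `G = 1`, object `G/H`;
monoid type `ℤ`, weak vocabulary of record). [cite: MochizukiEtTh2009, Def 3.6 p.77] -/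
def temperedFrobenioid (H : Subgroup PUnit.{1}) :
    TemperedFrobenioid (RealifiedDivisorMonoids.ofRlfZWeak (dm U hU) (hpf U hU)) (Discrete PUnit.{1})
      (treeCatVocab (Discrete PUnit.{1}) R S) :=
  TemperedFrobenioid.ofRankOneObject (rankOneObject U hU H) (hpf U hU) R S

/-- **NON-VACUITY of this lineage's coset-model theorem families** (`…_ofGaloisActionCoset…`, p443031 / p443606 / p444666):
`TemperedFrobenioid (ofRlfZWeak (DivisorMonoids.ofGaloisActionCoset A hZ) hpf) _ _` is INHABITED at `A :=` the trivial
action on the one-component model. [cite: MochizukiEtTh2009, Def 3.6 p.77] -/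
theorem nonempty_temperedFrobenioid_ofGaloisActionCoset :
    Nonempty (TemperedFrobenioid
      (RealifiedDivisorMonoids.ofRlfZWeak
        (DivisorMonoids.ofGaloisActionCoset (OneCompFrd.act U hU) (cuspLaws_oneComp U hU))
        (DivisorMonoids.ofGaloisActionCoset_isPerfFactorialCof (OneCompFrd.act U hU) (cuspLaws_oneComp U hU)))
      (Discrete PUnit.{1}) (treeCatVocab (Discrete PUnit.{1}) R S)) :=
  ⟨temperedFrobenioid U hU R S ⊤⟩

variable (Γ : Type) [Group Γ] [TopologicalSpace Γ] (R' S' : ((ConnectedPart (BTemp Γ))ᵒᵖ ⥤ CommMonCat.{0}) → Prop)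

/-- **… and over print's GENUINE base `B^temp(Π)⁰` for EVERY topological group `Π`** (the `…_connectedPart_bTemp` families and
the `mkOfConnectedTemperoid`-based Thm 4.4 files' `tf_i`). [cite: MochizukiEtTh2009, Def 3.6 p.77] -/
theorem nonempty_temperedFrobenioid_ofGaloisActionCoset_connectedPart :
    Nonempty (TemperedFrobenioid
      (RealifiedDivisorMonoids.ofRlfZWeak
        (DivisorMonoids.ofGaloisActionCoset (OneCompFrd.act U hU) (cuspLaws_oneComp U hU))
        (DivisorMonoids.ofGaloisActionCoset_isPerfFactorialCof (OneCompFrd.act U hU) (cuspLaws_oneComp U hU)))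
      (ConnectedPart (BTemp Γ)) (treeCatVocab (ConnectedPart (BTemp Γ)) R' S')) :=
  ⟨TemperedFrobenioid.ofRankOneObjectConnectedPart (rankOneObject U hU ⊤) (hpf U hU) (fun _ => True) (fun _ => True)
    Γ R' S'⟩

/-- The instance input is itself inhabited: `U := unit group`, `hU` trivial — so the non-vacuity is unconditional.
[cite: MochizukiEtTh2009, Def 3.6 p.77] -/
theorem nonempty_temperedFrobenioid_ofGaloisActionCoset_punit :
    Nonempty (TemperedFrobenioid
      (RealifiedDivisorMonoids.ofRlfZWeak
        (DivisorMonoids.ofGaloisActionCoset (OneCompFrd.act PUnit.{1} (fun _ _ => Subsingleton.elim _ _))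
          (cuspLaws_oneComp PUnit.{1} (fun _ _ => Subsingleton.elim _ _)))
        (DivisorMonoids.ofGaloisActionCoset_isPerfFactorialCof (OneCompFrd.act PUnit.{1} (fun _ _ => Subsingleton.elim _ _))
          (cuspLaws_oneComp PUnit.{1} (fun _ _ => Subsingleton.elim _ _))))
      (Discrete PUnit.{1}) (treeCatVocab (Discrete PUnit.{1}) R S)) :=
  nonempty_temperedFrobenioid_ofGaloisActionCoset PUnit.{1} (fun _ _ => Subsingleton.elim _ _) R S

end OneCompCoset

end Literature.AnabelianGeometry.EtaleTheta

end
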